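import Literature.NumberTheory.EllipticCurves.Kobayashi2003.SignedSelmer
import Literature.NumberTheory.NumberFields.CompletionLocalDegree
import Literature.NumberTheory.GaloisRepresentations.PadicAlgebraOfLocalField
import Mathlib.FieldTheory.Galois.Infinite
import Mathlib.FieldTheory.KrullTopology
import HarnessLib

/-!
# The local layer fields `K_n·K_v`: Galois descent `E(K_n·K_v) = E(K̄_v)^{Gal(K̄_v/K_n·K_v)}`,
# `[K_n·K_v : K_v] = [Γ_{K_v} : Gal(K̄_v/K_n·K_v)]` and `[K_n·K_v : ℚ_p] = [K_n·K_v : K_v]·e(v|p)f(v|p)`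

`Proofs` file (theorems only: no definition, no named fact, no instance) in topic
`NumberTheory/EllipticCurves`, cluster `Kobayashi2003`, namespace
`Literature.NumberTheory.EllipticCurves.Kobayashi2003` (= path) — the field-theoretic side of the
layers `E(K_n·K_v) = localLayerPointsOfEmb κ ι W n` of `Kobayashi2003/SignedSelmer.lean` (the points of
`E(K̄_v)` fixed by `Gal(K̄_v/K_n·K_v) = localLayerSubgroupOfEmb κ ι n`; S. Kobayashi, Invent. Math. 152
(2003), Def. 1.1: "`F_{n,p}` […] the completion of `F_n` at the place over `p`", "`E(F_{n,p})`").
For a field `E` with algebraic closure `K̄_E` and absolute Galois group `Γ_E` (Mathlib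
`Field.absoluteGaloisGroup E`, identified with `K̄_E ≃ₐ[E] K̄_E` by the tree's identity `MulEquiv`
`absoluteGaloisGroup.toAlgEquiv E`; a subgroup `G ≤ Γ_E` is moved to `K̄_E ≃ₐ[E] K̄_E` as
`G.comap (absoluteGaloisGroup.toAlgEquiv E).symm.toMonoidHom`, whose fixed field
`IntermediateField.fixedField _` is `K̄_E^G`):

* §1 **Galois descent for points of a fixed field** (any subgroup `G ≤ Γ_E`, any Weierstrass curve `W`
  over a subfield `K ⊆ E`): `x ∈ K̄_E^G ↔ ∀ σ ∈ G, σ • x = x` (`mem_fixedField_comap_iff`); the map on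
  points `E_W(K̄_E^G) → E(K̄_E) = localPoints W E` induced by the inclusion (Mathlib
  `WeierstrassCurve.Affine.Point.map`, injective) has image exactly the `G`-fixed points
  (`range_pointMap_fixedField_eq`), whence `nonempty_point_fixedField_addEquiv_fixedPoints :
  E_W(K̄_E^G) ≃+ E(K̄_E)^G` — Silverman, *AEC* VIII §1, proof of Prop. 1.2 ("`P^σ = P` for all `σ`
  iff the coordinates are fixed"), for an arbitrary subgroup;
* §2 **degree of the fixed field of an open subgroup** (`E` of characteristic `0`, so that `K̄_E/E`
  is Galois): `K̄_E^G/E` is finite of degree `[Γ_E : G]` (Krull topology; Mathlib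
  `InfiniteGalois.fixingSubgroup_fixedField`, `IntermediateField.finrank_eq_fixingSubgroup_index`,
  `InfiniteGalois.isOpen_iff_finite`; Neukirch, *ANT* IV (1.1));
* §3 **the local layers**: for a `ℤ_p`-extension `κ` of `K` and an embedding `ι : K̄ → K̄_E`, the
  layer subgroup `Gal(K̄_E/K_n·E) = localLayerSubgroupOfEmb κ ι n` is open, so the layer field
  `L_n = K̄_E^{Gal(K̄_E/K_n·E)} = K_n·E` is finite over `E` of degree `(localLayerSubgroupOfEmb κ ι n).index`
  and `E(K_n·E) = localLayerPointsOfEmb κ ι W n ≃+ E_W(L_n)`; for `K` a number field, `E = K_v` with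
  `v ∋ p` and the canonical continuous `ℚ_p`-structure of `K_v` (tree
  `LocalField.adicCompletionPadicAlgebra`) extended to `L_n`:
  `[L_n : ℚ_p] = (localLayerSubgroupOfEmb κ ι n).index · e(v|p) f(v|p)` (tree
  `finrank_adicCompletionPadicAlgebra_eq`: `[K_v : ℚ_p] = e f`, Neukirch II (8.5)) — the exponent of
  the named fact `silvermanVII63_localLayerPoints_finiteIndex_zpLattice`.

Written for the INPUTS desk of the BSD wall (unit `bsd-inputs-vii63-p1`): with
`LocalFieldPointsZpLatticeProofs` (Silverman VII.6.3 over a local field) it yields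
`silvermanVII63_localLayerPoints_finiteIndex_zpLattice_holds`. HONEST FRAMING: Galois and degree
bookkeeping only; BSD is not proved by any of this.

## References

* [Kobayashi2003] S. Kobayashi, Invent. Math. 152 (2003), Def. 1.1 (the layers `F_{n,p}`, `E(F_{n,p})`).
* [SilvermanAEC2009] J. H. Silverman, *The Arithmetic of Elliptic Curves*, 2nd ed. (2009), VIII §1,
  proof of Prop. 1.2 (Galois action on points, descent).
* [NeukirchANT1999] J. Neukirch, *Algebraic Number Theory* (1999), Ch. II (8.5) (`[L_w : K_v] = e f`),
  Ch. IV (1.1) (Krull topology: open subgroups ↔ finite subextensions).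
-/

noncomputable section

open scoped Classical

open NumberField IsDedekindDomain Field
open Literature.NumberTheory.EllipticCurves Literature.NumberTheory.GaloisRepresentations

universe u

namespace Literature.NumberTheory.EllipticCurves.Kobayashi2003

/-! ### §1 Galois descent: points over the fixed field `K̄_E^G` are the `G`-fixed points -/

section Descent

variable {K : Type u} [Field K] (W : WeierstrassCurve K) {E : Type u} [Field E] [Algebra K E]
  (G : Subgroup (absoluteGaloisGroup E))

omit [Algebra K E] in
/-- **The fixed field `K̄_E^G`**: `x ∈ K̄_E^G ↔ σ • x = x` for all `σ ∈ G` (unfolding of Mathlib's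
`IntermediateField.fixedField` along the identity `Γ_E = (K̄_E ≃ₐ[E] K̄_E)`). [folklore]
[cite: NeukirchANT1999, Ch. IV (1.1)] -/
theorem mem_fixedField_comap_iff (x : AlgebraicClosure E) :
    x ∈ IntermediateField.fixedField (G.comap (absoluteGaloisGroup.toAlgEquiv E).symm.toMonoidHom) ↔
      ∀ σ ∈ G, σ • x = x := by
  rw [IntermediateField.mem_fixedField_iff]
  constructor
  · intro h σ hσ
    exact h (absoluteGaloisGroup.toAlgEquiv E σ) (by rw [Subgroup.mem_comap]; simpa using hσ)
  · intro h f hf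
    rw [Subgroup.mem_comap] at hf
    have := h _ hf
    simpa using this

/-- **A point with coordinates in `K̄_E^G` is fixed by `G`** (`σ • P = P^σ` acts coordinatewise,
`localPoints.smul_def`). [cite: SilvermanAEC2009, VIII §1 (proof of Prop. 1.2)] -/
theorem smul_eq_self_of_mem_range {P : localPoints W E}
    (hP : P ∈ AddMonoidHom.range (N := localPoints W E) (WeierstrassCurve.Affine.Point.map
      ((IntermediateField.fixedField
        (G.comap (absoluteGaloisGroup.toAlgEquiv E).symm.toMonoidHom)).val.restrictScalars K)))
    {σ : absoluteGaloisGroup E} (hσ : σ ∈ G) : σ • P = P := by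
  obtain ⟨Q, rfl⟩ := hP
  have key : ((AlgEquiv.restrictScalars K (absoluteGaloisGroup.toAlgEquiv E σ) :
      AlgebraicClosure E ≃ₐ[K] AlgebraicClosure E) : AlgebraicClosure E →ₐ[K] AlgebraicClosure E).comp
      ((IntermediateField.fixedField
        (G.comap (absoluteGaloisGroup.toAlgEquiv E).symm.toMonoidHom)).val.restrictScalars K) =
      (IntermediateField.fixedField
        (G.comap (absoluteGaloisGroup.toAlgEquiv E).symm.toMonoidHom)).val.restrictScalars K := by
    ext x
    change (absoluteGaloisGroup.toAlgEquiv E σ) (x : AlgebraicClosure E) = x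
    exact (IntermediateField.mem_fixedField_iff _ _).mp x.2 _ (by rw [Subgroup.mem_comap]; simpa using hσ)
  rw [localPoints.smul_def]
  change WeierstrassCurve.Affine.Point.map ((AlgEquiv.restrictScalars K (absoluteGaloisGroup.toAlgEquiv E σ) :
      AlgebraicClosure E ≃ₐ[K] AlgebraicClosure E) : AlgebraicClosure E →ₐ[K] AlgebraicClosure E)
    (WeierstrassCurve.Affine.Point.map ((IntermediateField.fixedField
        (G.comap (absoluteGaloisGroup.toAlgEquiv E).symm.toMonoidHom)).val.restrictScalars K) Q) = _
  rw [WeierstrassCurve.Affine.Point.map_map, key]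
  rfl

/-- **A `G`-fixed point of `E(K̄_E)` has coordinates in `K̄_E^G`**, i.e. comes from `E_W(K̄_E^G)`.
[cite: SilvermanAEC2009, VIII §1 (proof of Prop. 1.2)] -/
theorem mem_range_of_forall_smul_eq {P : localPoints W E} (hP : ∀ σ ∈ G, σ • P = P) :
    P ∈ AddMonoidHom.range (N := localPoints W E) (WeierstrassCurve.Affine.Point.map
      ((IntermediateField.fixedField
        (G.comap (absoluteGaloisGroup.toAlgEquiv E).symm.toMonoidHom)).val.restrictScalars K)) := by
  change (W.baseChange (AlgebraicClosure E)).toAffine.Point at P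
  rcases P with _ | ⟨x, y, h⟩
  · exact ⟨0, rfl⟩
  · have hxy : ∀ σ ∈ G, σ • x = x ∧ σ • y = y := by
      intro σ hσ
      have h1 := hP σ hσ
      rw [localPoints.smul_def] at h1
      change WeierstrassCurve.Affine.Point.map ((AlgEquiv.restrictScalars K (absoluteGaloisGroup.toAlgEquiv E σ) :
        AlgebraicClosure E ≃ₐ[K] AlgebraicClosure E) : AlgebraicClosure E →ₐ[K] AlgebraicClosure E)
        (WeierstrassCurve.Affine.Point.some x y h) = WeierstrassCurve.Affine.Point.some x y h at h1
      rw [WeierstrassCurve.Affine.Point.map_some] at h1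
      have h2 := WeierstrassCurve.Affine.Point.some.inj h1
      exact ⟨h2.1, h2.2⟩
    have hx : x ∈ IntermediateField.fixedField (G.comap (absoluteGaloisGroup.toAlgEquiv E).symm.toMonoidHom) :=
      (mem_fixedField_comap_iff G x).mpr fun σ hσ ↦ (hxy σ hσ).1
    have hy : y ∈ IntermediateField.fixedField (G.comap (absoluteGaloisGroup.toAlgEquiv E).symm.toMonoidHom) :=
      (mem_fixedField_comap_iff G y).mpr fun σ hσ ↦ (hxy σ hσ).2
    have h' : (W.baseChange (IntermediateField.fixedField
        (G.comap (absoluteGaloisGroup.toAlgEquiv E).symm.toMonoidHom))).toAffine.Nonsingular ⟨x, hx⟩ ⟨y, hy⟩ :=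
      (W.toAffine.baseChange_nonsingular (f := (IntermediateField.fixedField
        (G.comap (absoluteGaloisGroup.toAlgEquiv E).symm.toMonoidHom)).val.restrictScalars K)
        ((IntermediateField.fixedField
          (G.comap (absoluteGaloisGroup.toAlgEquiv E).symm.toMonoidHom)).val.restrictScalars K).injective
        ..).mp h
    exact ⟨WeierstrassCurve.Affine.Point.some _ _ h', rfl⟩

/-- **Galois descent for points: `E_W(K̄_E^G) = E(K̄_E)^G`.** The image of the (injective) map on points
induced by `K̄_E^G ⊆ K̄_E` is the subgroup of `G`-fixed points of `localPoints W E` (Mathlib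
`FixedPoints.addSubgroup`; for `G = Gal(K̄_v/K_n·K_v)` this is `localLayerPointsOfEmb κ ι W n`).
Silverman, *AEC* VIII §1 (proof of Prop. 1.2), for an arbitrary subgroup `G ≤ Γ_E`.
[cite: SilvermanAEC2009, VIII §1 (proof of Prop. 1.2)] -/
theorem range_pointMap_fixedField_eq :
    AddMonoidHom.range (N := localPoints W E) (WeierstrassCurve.Affine.Point.map
      ((IntermediateField.fixedField
        (G.comap (absoluteGaloisGroup.toAlgEquiv E).symm.toMonoidHom)).val.restrictScalars K)) =
      FixedPoints.addSubgroup G (localPoints W E) := by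
  ext P
  constructor
  · intro hP
    exact fun σ ↦ smul_eq_self_of_mem_range W G hP σ.2
  · intro hP
    exact mem_range_of_forall_smul_eq W G fun σ hσ ↦ hP ⟨σ, hσ⟩

/-- **`E_W(K̄_E^G) ≃+ E(K̄_E)^G`** (Galois descent packaged as an additive isomorphism onto the subgroup
of `G`-fixed points). [cite: SilvermanAEC2009, VIII §1 (proof of Prop. 1.2)] -/
theorem nonempty_point_fixedField_addEquiv_fixedPoints :
    Nonempty ((W.baseChange (IntermediateField.fixedField
        (G.comap (absoluteGaloisGroup.toAlgEquiv E).symm.toMonoidHom))).toAffine.Point ≃+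
      FixedPoints.addSubgroup G (localPoints W E)) := by
  have hinj := WeierstrassCurve.Affine.Point.map_injective (W' := W) ((IntermediateField.fixedField
        (G.comap (absoluteGaloisGroup.toAlgEquiv E).symm.toMonoidHom)).val.restrictScalars K)
  exact ⟨(AddMonoidHom.ofInjective (N := localPoints W E) hinj).trans
    (AddEquiv.addSubgroupCongr (range_pointMap_fixedField_eq W G))⟩

end Descent

/-! ### §2 The fixed field of an open subgroup is finite over `E` of degree the index -/

section Degree

variable {E : Type u} [Field E] (G : Subgroup (absoluteGaloisGroup E))

/-- An open subgroup of `Γ_E`, moved to `K̄_E ≃ₐ[E] K̄_E`, is closed (open subgroups of a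
topological group are closed). [folklore] [cite: NeukirchANT1999, Ch. IV (1.1)] -/
theorem isClosed_comap_toAlgEquiv (hG : IsOpen (G : Set (absoluteGaloisGroup E))) :
    IsClosed ((G.comap (absoluteGaloisGroup.toAlgEquiv E).symm.toMonoidHom :
      Subgroup (AlgebraicClosure E ≃ₐ[E] AlgebraicClosure E)) :
        Set (AlgebraicClosure E ≃ₐ[E] AlgebraicClosure E)) :=
  Subgroup.isClosed_of_isOpen _ hG

variable [CharZero E]

/-- **`[K̄_E^G : E] = [Γ_E : G]` for an open subgroup `G`** of the absolute Galois group of a field of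
characteristic `0` (`K̄_E/E` is Galois; Krull topology: `Gal(K̄_E/K̄_E^G) = G` for closed `G`, Mathlib
`InfiniteGalois.fixingSubgroup_fixedField`, and `[L : E] = [Γ_E : Gal(K̄_E/L)]`,
`IntermediateField.finrank_eq_fixingSubgroup_index`). Neukirch, *ANT* IV (1.1).
[cite: NeukirchANT1999, Ch. IV (1.1)] -/
theorem finrank_fixedField_eq_index (hG : IsOpen (G : Set (absoluteGaloisGroup E))) :
    Module.finrank E (IntermediateField.fixedField
      (G.comap (absoluteGaloisGroup.toAlgEquiv E).symm.toMonoidHom)) = G.index := by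
  rw [IntermediateField.finrank_eq_fixingSubgroup_index,
    InfiniteGalois.fixingSubgroup_fixedField (k := E) (K := AlgebraicClosure E)
      ⟨_, isClosed_comap_toAlgEquiv G hG⟩]
  exact Subgroup.index_comap_of_surjective _ (absoluteGaloisGroup.toAlgEquiv E).symm.surjective

/-- The fixed field of an open subgroup is a finite extension of `E` (Mathlib
`InfiniteGalois.isOpen_iff_finite`). [cite: NeukirchANT1999, Ch. IV (1.1)] -/
theorem finiteDimensional_fixedField (hG : IsOpen (G : Set (absoluteGaloisGroup E))) :
    FiniteDimensional E (IntermediateField.fixedField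
      (G.comap (absoluteGaloisGroup.toAlgEquiv E).symm.toMonoidHom)) := by
  refine (InfiniteGalois.isOpen_iff_finite _).mp ?_
  rw [InfiniteGalois.fixingSubgroup_fixedField (k := E) (K := AlgebraicClosure E)
      ⟨_, isClosed_comap_toAlgEquiv G hG⟩]
  exact hG

end Degree

/-! ### §3 The local layers `K_n·E` of a `ℤ_p`-tower -/

section Layer

variable {K : Type u} [Field K] {p : ℕ} [Fact p.Prime] (κ : ZpExtension K p)
  {E : Type u} [Field E] [Algebra K E] (ι : AlgebraicClosure K →ₐ[K] AlgebraicClosure E)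

/-- `Gal(K̄_E/K_n·E)` is OPEN in `Γ_E` (preimage of the open layer subgroup `κ⁻¹(pⁿℤ_p)` under the
continuous restriction `Γ_E → Γ_K`). [cite: Kobayashi2003, Def. 1.1] -/
theorem isOpen_localLayerSubgroupOfEmb (n : ℕ) :
    IsOpen (localLayerSubgroupOfEmb κ ι n : Set (absoluteGaloisGroup E)) :=
  (κ.isOpen_layerSubgroup n).preimage (map_continuous (resGalOfEmb ι))

/-- **`E_W(L_n) ≃+ E(K_n·E)`**: the points of `W` over the layer field
`L_n = K̄_E^{Gal(K̄_E/K_n·E)} = K_n·E` (Kobayashi's `F_{n,p}`, Def. 1.1) are the layer points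
`localLayerPointsOfEmb κ ι W n` (the points of `E(K̄_E)` fixed by `Gal(K̄_E/K_n·E)`), by Galois
descent (§1). [cite: Kobayashi2003, Def. 1.1] [cite: SilvermanAEC2009, VIII §1 (proof of Prop. 1.2)] -/
theorem nonempty_point_layerField_addEquiv_localLayerPointsOfEmb (W : WeierstrassCurve K) (n : ℕ) :
    Nonempty ((W.baseChange (IntermediateField.fixedField ((localLayerSubgroupOfEmb κ ι n).comap
        (absoluteGaloisGroup.toAlgEquiv E).symm.toMonoidHom))).toAffine.Point ≃+
      localLayerPointsOfEmb κ ι W n) :=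
  nonempty_point_fixedField_addEquiv_fixedPoints W (localLayerSubgroupOfEmb κ ι n)

variable [CharZero E]

/-- **`[K_n·E : E] = [Γ_E : Gal(K̄_E/K_n·E)] = (localLayerSubgroupOfEmb κ ι n).index`** (a divisor of
`pⁿ`, `index_localLayerSubgroupOfEmb_dvd`), for `E` of characteristic `0`.
[cite: Kobayashi2003, Def. 1.1] [cite: NeukirchANT1999, Ch. IV (1.1)] -/
theorem finrank_layerField_eq_index (n : ℕ) :
    Module.finrank E (IntermediateField.fixedField ((localLayerSubgroupOfEmb κ ι n).comap
        (absoluteGaloisGroup.toAlgEquiv E).symm.toMonoidHom)) = (localLayerSubgroupOfEmb κ ι n).index :=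
  finrank_fixedField_eq_index _ (isOpen_localLayerSubgroupOfEmb κ ι n)

/-- The layer field `K_n·E` is a finite extension of `E`. [cite: Kobayashi2003, Def. 1.1] -/
theorem finiteDimensional_layerField (n : ℕ) :
    FiniteDimensional E (IntermediateField.fixedField ((localLayerSubgroupOfEmb κ ι n).comap
        (absoluteGaloisGroup.toAlgEquiv E).symm.toMonoidHom)) :=
  finiteDimensional_fixedField _ (isOpen_localLayerSubgroupOfEmb κ ι n)

end Layer

section Padic

variable {K : Type} [Field K] [NumberField K] {p : ℕ} [Fact p.Prime] (κ : ZpExtension K p)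
  (v : HeightOneSpectrum (𝓞 K)) (ι : AlgebraicClosure K →ₐ[K] AlgebraicClosure (v.adicCompletion K))

/-- **`[K_n·K_v : ℚ_p] = [K_n·K_v : K_v] · e(v|p) f(v|p)`** for a place `v ∋ p` of a number field `K`:
for ANY `ℚ_p`-algebra structure on `K_v` with continuous structure map (there is exactly one, the
tree's `LocalField.adicCompletionPadicAlgebra`; `[K_v : ℚ_p] = e f` is the tree's
`finrank_padic_adicCompletion_eq`, Neukirch II (8.5)) and any `ℚ_p`-structure on the layer field
`L_n = K_n·K_v` making `ℚ_p → K_v → L_n` a scalar tower, the `ℚ_p`-degree of `L_n` is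
`(localLayerSubgroupOfEmb κ ι n).index · (e(v|p) f(v|p))` — the exponent `d` of the named fact
`silvermanVII63_localLayerPoints_finiteIndex_zpLattice`.
[cite: NeukirchANT1999, Ch. II (8.5)] [cite: Kobayashi2003, Def. 1.1] -/
theorem finrank_padic_layerField_eq (hv : ((p : ℕ) : 𝓞 K) ∈ v.asIdeal) (n : ℕ)
    [Algebra ℚ_[p] (v.adicCompletion K)] (hc : Continuous (algebraMap ℚ_[p] (v.adicCompletion K)))
    [Algebra ℚ_[p] (IntermediateField.fixedField ((localLayerSubgroupOfEmb κ ι n).comap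
        (absoluteGaloisGroup.toAlgEquiv (v.adicCompletion K)).symm.toMonoidHom))]
    [IsScalarTower ℚ_[p] (v.adicCompletion K)
        (IntermediateField.fixedField ((localLayerSubgroupOfEmb κ ι n).comap
          (absoluteGaloisGroup.toAlgEquiv (v.adicCompletion K)).symm.toMonoidHom))] :
    Module.finrank ℚ_[p] (IntermediateField.fixedField ((localLayerSubgroupOfEmb κ ι n).comap
        (absoluteGaloisGroup.toAlgEquiv (v.adicCompletion K)).symm.toMonoidHom)) =
      (localLayerSubgroupOfEmb κ ι n).index * (v.asIdeal.ramificationIdx ℤ * v.asIdeal.inertiaDeg ℤ) := by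
  haveI : CharZero (v.adicCompletion K) := LocalField.charZero_adicCompletion v
  haveI := finiteDimensional_layerField κ ι (E := v.adicCompletion K) n
  have h := Module.finrank_mul_finrank ℚ_[p] (v.adicCompletion K)
      (IntermediateField.fixedField ((localLayerSubgroupOfEmb κ ι n).comap
        (absoluteGaloisGroup.toAlgEquiv (v.adicCompletion K)).symm.toMonoidHom))
  rw [Literature.NumberTheory.NumberFields.finrank_padic_adicCompletion_eq p v hv hc,
    finrank_layerField_eq_index] at h
  rw [← h, mul_comm]

end Padic

end Literature.NumberTheory.EllipticCurves.Kobayashi2003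

end
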